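/-
Copyright (c) 2026 the pub-hodgecm-mathlib formalisation cell (harness21).  Prover seat hodgecm-mathlib-K2E1-p13 (g6), Track B ∕ K2-LIT, h413 = `stmt-HodgeConjecture-24833`,
R90-TF section S8 «ContSpec-n½», S8 dealer R90-CS-plan (g4) S8-R254 (7) (this seat's census (M1)): (V) OF RECORD's `hsrc` binder — the COORDINATE sum `Σ_j midWitnessQ_j(z)·(bV_j g₁·Θ g₁)`
at the base point — FROM the constant-term quotient `Θ(g₁)·(CT(midWitnessEc z)(g₁) − φ(g₁)H(g₁)^z)∕H(g₁)^{2−z}`, the currency in which the unfolding of record (★ p864821) is written.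
-/
import Summits.HodgeConjecture.HodgeConjecture.Theorems.R90S8MidWitnessExportsU3Defs            -- ★ (R90-C133-p02): `midWitnessQ`, `midWitnessEc`, `midWitnessExports_spec` (clause 2: the tube coordinate identity)
import Summits.HodgeConjecture.HodgeConjecture.Theorems.K2E1ChiEisensteinConstantTermCMThree     -- ★ (U1) (K2E1-p15): `borelConstantTerm_chiPairEisenstein_cm_three_eq_add_mul`
import Summits.HodgeConjecture.HodgeConjecture.Theorems.K2E1ChiAmplitudeOfTranslateU3            -- ★ p864776 (this seat): `smul_apply_eq_sum_mul_of_sum_smul_eq`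
import HarnessLib

/-!
# R90-TF · S8 «ContSpec-n½» — `R90S8MidWitnessSrcOfCTQuotientU3`: (V) OF RECORD's `hsrc` FROM THE CONSTANT-TERM QUOTIENT AT THE BASE POINT

Cell `hodgecm-mathlib`, crux H413 (`stmt-HodgeConjecture-24833`, lane `--supports … --as helper`), route of record `HCCMUnconditional`; R90-TF section S8, socket (V)
`sock_S8_res_midBlock_ne_bot` (B ED. 7 :358), head ★ `resGMidBlock_ne_bot_of_record_v14` (K2E1-p15), binder `hsrc`.  THEOREMS ONLY (no `def`, no `instance`, no `notation`, no
named-fact hypothesis, no `sorry`; default heartbeats); count-neutral; CLOSES NO SOCKET.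

THE POINT (this seat's census of S8-R254 (7), mismatch (M1)).  ED. 12–14 of (V) OF RECORD carry
`hsrc : ∀ z, 2 < Re z → Σ_j midWitnessQ_j(z)·(bV_j(g₁)·Θ(g₁)) = A(z)·c(z)` (`Θ = detChar ξ.ψ`, `A` the named amplitude, `c` the block's scalar) — the COORDINATE currency of the named exports —
whereas the unfolding of record (★ `hsrc_of_record_at_basePoint_of_core`, p864821) delivers the CONSTANT-TERM currency `(CT(Ec z)(ι_f b₁) − φ(ι_f b₁)H^z)∕H^{2−z} = C·(…)·c(z)`.  The two
are the same function on the tube: clause 2 of ★ `midWitnessExports_spec` («`Σ_j Q_j(z)•bV_j = (ν𝓕)⁻¹•(g ↦ ∫_N φ_z(w₀vg) dν·H(g)^{z−2})`»), ★ (U1) («`CT(E(φ_z))(g) = φ_z(g) + (ν𝓕)⁻¹∫_N φ_z(w₀vg) dν`»,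
[MoeglinWaldspurger1995, II.1.7]) and `H^{z−2}·H^{2−z} = 1` give, for `2 < Re z` and every `g`,
**`(CT(midWitnessEc z)(g) − φ(g)·H(g)^z) ∕ H(g)^{2−z} = Σ_j midWitnessQ_j(z)·bV_j(g)`** (§1) — V12 §1's `hexpU`, now a citable theorem about the NAMED exports — hence (§2)
**`hsrc` ⟸ `∀ z, 2 < Re z → Θ(g₁)·(CT(midWitnessEc z)(g₁) − φ(g₁)H(g₁)^z)∕H(g₁)^{2−z} = A(z)·c(z)`**, for ANY `A, c : ℂ → ℂ` and any base point `g₁` (the keeper instantiates `A` := the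
named lambda, `c` := the partial-`L` quotient; the CT side is what ★ p864821's successors pay, with `Θ(g₁)` absorbed into the constant `C`).
* §1 **`midWitness_ctQuotient_eq_sum`** — the untwisted coordinate expansion of the second constant-term coefficient of the NAMED family on the tube, at every `g`.
* §2 **`hsrc_of_ctQuotient_at_basePoint`** — (V)'s `hsrc` bytes (generic frame of ★ `midWitnessQ`) from the CT-quotient identity at `g₁`; **`hsrc_of_ctQuotient_at_basePoint_of_detChar_eq_one`**
  — the same when `Θ(g₁) = 1` (e.g. `g₁ = 1`).
HONEST LABEL: HC_CM is proved only modulo the 7 printed citations (2 remaining named inputs: hLiu418 = `stmt-HodgeConjecture-24832`, h413 = `stmt-HodgeConjecture-24833`) until rung 0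
closes; REL ≠ ★ ≠ BUILT; this file is a currency bridge (letter-free), asserts no named fact and closes no socket; the other mismatches of the census ((M2) the scalar's `(S, T′)`,
(M3) the witness identification `φ^{pair} = φ₀·Θ`, (M4) ★ p864821's own letters) are untouched; count-neutral.

## References
* [MoeglinWaldspurger1995] C. Mœglin, J.-L. Waldspurger, *Spectral Decomposition and Eisenstein Series* (1995), II.1.7, IV.1.8–IV.1.11.
* [BernsteinLapid2019] J. Bernstein, E. Lapid, *On the meromorphic continuation of Eisenstein series*, J. AMS 37 (2024), Thm 2.3, §4.
* [Rogawski1990] J. D. Rogawski, *Automorphic Representations of Unitary Groups in Three Variables* (1990), §13.9 p. 229.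
-/

set_option autoImplicit false
set_option linter.dupNamespace false  -- the mandated namespace `…HodgeConjecture.HodgeConjecture.R90.S8` (LEAD #1 L1) repeats the summit's segment

noncomputable section

open MeasureTheory Measure Filter Topology Set NumberField IsDedekindDomain
open scoped NNReal ENNReal
open Literature.NumberTheory Literature.NumberTheory.Automorphic Literature.NumberTheory.Automorphic.UnitaryGroup Literature.NumberTheory.GaloisRepresentations AdelicGroupData
open Literature.NumberTheory.Automorphic.Arthur2013.Leaves.TECR Literature.MeasureTheory.Group
open Summit.HodgeConjecture.HodgeConjecture.Cruxes.H413.K2E1BorelEisensteinU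
open Summit.HodgeConjecture.HodgeConjecture.Cruxes.H413.K2E1BLBorelSpacesU2Defs Summit.HodgeConjecture.HodgeConjecture.Cruxes.H413.K2E1BLBorelOperatorsU2Defs
open Summit.HodgeConjecture.HodgeConjecture.Cruxes.H413.K2E1CharacterEisensteinU2Defs
open Summit.HodgeConjecture.HodgeConjecture.Cruxes.H413.K2E1ChiSectionSpaceU2Defs
open Summit.HodgeConjecture.HodgeConjecture.Cruxes.H413.K2E1CharacterEisensteinU3PairDefs
open Summit.HodgeConjecture.HodgeConjecture.Cruxes.H413.K2E1ChiSectionSpaceU3PairDefs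
open Summit.HodgeConjecture.HodgeConjecture.Cruxes.H413.K2E1ChiEisensteinConstantTermCMThree (borelConstantTerm_chiPairEisenstein_cm_three_eq_add_mul)
open Summit.HodgeConjecture.HodgeConjecture.Cruxes.H413.K2E1ChiAmplitudeOfTranslateU3 (smul_apply_eq_sum_mul_of_sum_smul_eq)

namespace Summit.HodgeConjecture.HodgeConjecture.R90.S8

variable (L : Type) [Field L] [NumberField L] [IsCMField L]
  [MeasurableSpace (quasiSplit (↥(maximalRealSubfield L)) L (IsCMField.complexConj L) 3).Adelic] [BorelSpace (quasiSplit (↥(maximalRealSubfield L)) L (IsCMField.complexConj L) 3).Adelic]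
  [MeasurableSpace (arch (↥(maximalRealSubfield L)) L (IsCMField.complexConj L) 3 ((StdForm.antidiagonal 3).over L))] [BorelSpace (arch (↥(maximalRealSubfield L)) L (IsCMField.complexConj L) 3 ((StdForm.antidiagonal 3).over L))]
  [MeasurableSpace (finAdelic (↥(maximalRealSubfield L)) L (IsCMField.complexConj L) 3 ((StdForm.antidiagonal 3).over L))] [BorelSpace (finAdelic (↥(maximalRealSubfield L)) L (IsCMField.complexConj L) 3 ((StdForm.antidiagonal 3).over L))]
  (μ : Measure (quasiSplit (↥(maximalRealSubfield L)) L (IsCMField.complexConj L) 3).automorphicQuotient) [(quasiSplit (↥(maximalRealSubfield L)) L (IsCMField.complexConj L) 3).IsAutomorphicMeasure μ]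
  (νG : Measure (quasiSplit (↥(maximalRealSubfield L)) L (IsCMField.complexConj L) 3).Adelic) [νG.IsHaarMeasure] [νG.IsInvInvariant] [SFinite νG]
  (ν : Measure ↥(adelicUnipotent (↥(maximalRealSubfield L)) L (IsCMField.complexConj L) 3)) [ν.IsHaarMeasure] [ν.IsMulRightInvariant] [ν.IsInvInvariant]
  {𝓕 : Set ↥(adelicUnipotent (↥(maximalRealSubfield L)) L (IsCMField.complexConj L) 3)}
  (h𝓕N : IsFundamentalDomain ↥(rationalUnipotent (↥(maximalRealSubfield L)) L (IsCMField.complexConj L) 3) 𝓕 ν) (h𝓕c : IsCompact (closure 𝓕)) (h𝓕₀ : ν 𝓕 ≠ 0)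
  {β : (quasiSplit (↥(maximalRealSubfield L)) L (IsCMField.complexConj L) 3).Adelic → ℝ≥0∞}
  (hβ : IsCoveringWeight ↥((arithmeticBorel (↥(maximalRealSubfield L)) L (IsCMField.complexConj L) 3).map (quasiSplit (↥(maximalRealSubfield L)) L (IsCMField.complexConj L) 3).arithmeticSubgroup.subtype) β)
  {μZ : Measure (borelQuotient (↥(maximalRealSubfield L)) L (IsCMField.complexConj L) 3)} [SFinite μZ]
  (hμZ : ∀ f : borelQuotient (↥(maximalRealSubfield L)) L (IsCMField.complexConj L) 3 → ℝ≥0∞, Measurable f → ∫⁻ z, f z ∂μZ = ∫⁻ g, β g * f (toBorelQuotient (↥(maximalRealSubfield L)) L (IsCMField.complexConj L) 3 g) ∂νG)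
  {χ : HeckeCharacter L} {K' : Subgroup (quasiSplit (↥(maximalRealSubfield L)) L (IsCMField.complexConj L) 3).Adelic} {ω : ↥K' → ℂ}
  {φ : (quasiSplit (↥(maximalRealSubfield L)) L (IsCMField.complexConj L) 3).Adelic → ℂ} (hφV : φ ∈ chiSectionSpace χ K' ω) (hφc : Continuous φ) {Mφ : ℝ} (hφM : ∀ x, ‖φ x‖ ≤ Mφ)
  (hK' : K' ≤ ((standardMaximalCompactGL 3 L).comap (adelicVal (↥(maximalRealSubfield L)) L (IsCMField.complexConj L) 3 ((StdForm.antidiagonal 3).over L)) : Subgroup (quasiSplit (↥(maximalRealSubfield L)) L (IsCMField.complexConj L) 3).Adelic))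
  (hKinf : ∀ k : arch (↥(maximalRealSubfield L)) L (IsCMField.complexConj L) 3 ((StdForm.antidiagonal 3).over L), adelicVal (↥(maximalRealSubfield L)) L (IsCMField.complexConj L) 3 ((StdForm.antidiagonal 3).over L) (archToAdelic (↥(maximalRealSubfield L)) L (IsCMField.complexConj L) 3 _ k) ∈ standardMaximalCompactGL 3 L →
    archToAdelic (↥(maximalRealSubfield L)) L (IsCMField.complexConj L) 3 _ k ∈ K')
  (U₀ : Subgroup (GL (Fin 3) (FiniteAdeleRing (𝓞 L) L))) (hU₀o : IsOpen (U₀ : Set (GL (Fin 3) (FiniteAdeleRing (𝓞 L) L)))) (hU₀c : IsCompact (U₀ : Set (GL (Fin 3) (FiniteAdeleRing (𝓞 L) L))))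
  (hU : ∀ b : finAdelic (↥(maximalRealSubfield L)) L (IsCMField.complexConj L) 3 ((StdForm.antidiagonal 3).over L), (b : GL (Fin 3) (FiniteAdeleRing (𝓞 L) L)) ∈ U₀ →
    ∃ hb : finAdelicToAdelic (↥(maximalRealSubfield L)) L (IsCMField.complexConj L) 3 ((StdForm.antidiagonal 3).over L) b ∈ K', ω ⟨_, hb⟩ = 1)
  (hVc : ∀ φ ∈ chiSectionSpace χ K' ω, Continuous φ)
  (μa : Measure (arch (↥(maximalRealSubfield L)) L (IsCMField.complexConj L) 3 ((StdForm.antidiagonal 3).over L))) [μa.IsHaarMeasure] [μa.IsMulRightInvariant]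
  (μf : Measure (finAdelic (↥(maximalRealSubfield L)) L (IsCMField.complexConj L) 3 ((StdForm.antidiagonal 3).over L))) [μf.IsHaarMeasure]
  {ι' : Type} [Fintype ι'] [DecidableEq ι'] (bV : Module.Basis ι' ℂ ↥(chiSectionSpace (reflectChar (IsCMField.complexConj L) χ) K' ω))
  (hbc : ∀ j, Continuous ((bV j : ↥(chiSectionSpace (reflectChar (IsCMField.complexConj L) χ) K' ω)) : (quasiSplit (↥(maximalRealSubfield L)) L (IsCMField.complexConj L) 3).Adelic → ℂ)) {Mb : ℝ}
  (hbM : ∀ j x, ‖((bV j : ↥(chiSectionSpace (reflectChar (IsCMField.complexConj L) χ) K' ω)) : (quasiSplit (↥(maximalRealSubfield L)) L (IsCMField.complexConj L) 3).Adelic → ℂ) x‖ ≤ Mb)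
  (h2 : Module.finrank (↥(maximalRealSubfield L)) L = 2) (hc : IsCMField.complexConj L ≠ 1) (hJ : ((StdForm.antidiagonal 3).over L).det ≠ 0)
  (ψ : ↥(TorusDict.torus (IsCMField.complexConj L)) →ₜ* ℂˣ) (hψ : TorusDict.IsAutomorphic (IsCMField.complexConj L) ψ)

/-! ## §1 The untwisted coordinate expansion of the second CT coefficient of the NAMED family on the tube -/

include h𝓕N h𝓕c in
/-- **`(CT(midWitnessEc z)(g) − φ(g)·H(g)^z) ∕ H(g)^{2−z} = Σ_j midWitnessQ_j(z)·bV_j(g)`** for `2 < Re z` and every `g`: clause 2 of ★ `midWitnessExports_spec` read at `g` (★ `smul_apply_eq_sum_mul_of_sum_smul_eq`),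
the tube identity `midWitnessEc z = E(φ_z)`, ★ (U1) `CT(E(φ_z))(g) = φ_z(g) + (ν𝓕)⁻¹∫_N φ_z(w₀vg) dν` (`φ` is a `(χ, 1)`-pair-section, continuous, bounded) and `H^{z−2}·H^{2−z} = 1` (`H(g) > 0`).
[cite: MoeglinWaldspurger1995, II.1.7, IV.1.8] [cite: BernsteinLapid2019, Thm 2.3] -/
theorem midWitness_ctQuotient_eq_sum {z : ℂ} (hz : 2 < z.re) (g : (quasiSplit (↥(maximalRealSubfield L)) L (IsCMField.complexConj L) 3).Adelic) :
    (borelConstantTerm ν 𝓕 (midWitnessEc L μ νG ν h𝓕N h𝓕c h𝓕₀ hβ hμZ hφV hφc hφM hK' hKinf U₀ hU₀o hU₀c hU hVc μa μf bV hbc hbM h2 hc hJ ψ hψ z) g -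
        φ g * (((borelHeight g : ℝ≥0) : ℝ) : ℂ) ^ z) / (((borelHeight g : ℝ≥0) : ℝ) : ℂ) ^ (2 - z) =
      ∑ j, midWitnessQ L μ νG ν h𝓕N h𝓕c h𝓕₀ hβ hμZ hφV hφc hφM hK' hKinf U₀ hU₀o hU₀c hU hVc μa μf bV hbc hbM h2 hc hJ ψ hψ j z *
        ((bV j : ↥(chiSectionSpace (reflectChar (IsCMField.complexConj L) χ) K' ω)) : (quasiSplit (↥(maximalRealSubfield L)) L (IsCMField.complexConj L) 3).Adelic → ℂ) g := by
  obtain ⟨-, hqφ, -, -, hE2, -⟩ := midWitnessExports_spec L μ νG ν h𝓕N h𝓕c h𝓕₀ hβ hμZ hφV hφc hφM hK' hKinf U₀ hU₀o hU₀c hU hVc μa μf bV hbc hbM h2 hc hJ ψ hψ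
  rw [← smul_apply_eq_sum_mul_of_sum_smul_eq (hqφ z hz) g]
  have hφpair : IsChiSectionPair χ (1 : ↥(TorusDict.torus (IsCMField.complexConj L)) →ₜ* ℂˣ) φ :=
    IsChiSection.isChiSectionPair_of_trivial (fun t => by rw [ContinuousMonoidHom.coe_one, Pi.one_apply]) (isChiSection_of_mem hφV)
  have h1aut : TorusDict.IsAutomorphic (IsCMField.complexConj L) (1 : ↥(TorusDict.torus (IsCMField.complexConj L)) →ₜ* ℂˣ) := fun t _ => by
    rw [ContinuousMonoidHom.coe_one, Pi.one_apply]
  have hH : (((borelHeight g : ℝ≥0) : ℝ) : ℂ) ≠ 0 := Complex.ofReal_ne_zero.2 (NNReal.coe_pos.2 (borelHeight_pos g)).ne'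
  have hpow : (((borelHeight g : ℝ≥0) : ℝ) : ℂ) ^ (2 - z) ≠ 0 := fun h => hH ((Complex.cpow_eq_zero_iff _ _).1 h).1
  rw [div_eq_iff hpow, hE2 z hz, borelConstantTerm_chiPairEisenstein_cm_three_eq_add_mul L ν h𝓕N h𝓕c h1aut hφpair hφc hφM hz g,
    flatSectionU_apply φ z g, add_sub_cancel_left, mul_assoc, mul_assoc, ← Complex.cpow_add _ _ hH, show z - 2 + (2 - z) = 0 by ring, Complex.cpow_zero, mul_one]

/-! ## §2 (V)'s `hsrc` from the CT-quotient identity at the base point -/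

include h𝓕N h𝓕c in
/-- **(V) OF RECORD's `hsrc` FROM THE CONSTANT-TERM QUOTIENT AT `g₁`**: for any `A, c : ℂ → ℂ` and any base point `g₁`, if
`Θ(g₁)·(CT(midWitnessEc z)(g₁) − φ(g₁)H(g₁)^z)∕H(g₁)^{2−z} = A(z)·c(z)` on `{2 < Re}` (`Θ = detChar ψ`), then `Σ_j midWitnessQ_j(z)·(bV_j(g₁)·Θ(g₁)) = A(z)·c(z)` on `{2 < Re}` — the binder
`hsrc` of ★ `resGMidBlock_ne_bot_of_record_v13∕v14` byte for byte (its frame instantiated by the keeper). [cite: MoeglinWaldspurger1995, II.1.7, IV.1.11] [cite: Rogawski1990, §13.9 p. 229] -/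
theorem hsrc_of_ctQuotient_at_basePoint (A c : ℂ → ℂ) (g₁ : (quasiSplit (↥(maximalRealSubfield L)) L (IsCMField.complexConj L) 3).Adelic)
    (hct : ∀ z : ℂ, 2 < z.re →
      ((detChar (↥(maximalRealSubfield L)) L (IsCMField.complexConj L) h2 hc 3 ((StdForm.antidiagonal 3).over L) ψ hψ hJ g₁ : ℂˣ) : ℂ) *
          ((borelConstantTerm ν 𝓕 (midWitnessEc L μ νG ν h𝓕N h𝓕c h𝓕₀ hβ hμZ hφV hφc hφM hK' hKinf U₀ hU₀o hU₀c hU hVc μa μf bV hbc hbM h2 hc hJ ψ hψ z) g₁ -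
              φ g₁ * (((borelHeight g₁ : ℝ≥0) : ℝ) : ℂ) ^ z) / (((borelHeight g₁ : ℝ≥0) : ℝ) : ℂ) ^ (2 - z)) = A z * c z) :
    ∀ z : ℂ, 2 < z.re → (∑ j, midWitnessQ L μ νG ν h𝓕N h𝓕c h𝓕₀ hβ hμZ hφV hφc hφM hK' hKinf U₀ hU₀o hU₀c hU hVc μa μf bV hbc hbM h2 hc hJ ψ hψ j z *
      (((bV j : ↥(chiSectionSpace (reflectChar (IsCMField.complexConj L) χ) K' ω)) : (quasiSplit (↥(maximalRealSubfield L)) L (IsCMField.complexConj L) 3).Adelic → ℂ) g₁ *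
        ((detChar (↥(maximalRealSubfield L)) L (IsCMField.complexConj L) h2 hc 3 ((StdForm.antidiagonal 3).over L) ψ hψ hJ g₁ : ℂˣ) : ℂ))) = A z * c z := by
  intro z hz
  have hsum : (∑ j, midWitnessQ L μ νG ν h𝓕N h𝓕c h𝓕₀ hβ hμZ hφV hφc hφM hK' hKinf U₀ hU₀o hU₀c hU hVc μa μf bV hbc hbM h2 hc hJ ψ hψ j z *
      (((bV j : ↥(chiSectionSpace (reflectChar (IsCMField.complexConj L) χ) K' ω)) : (quasiSplit (↥(maximalRealSubfield L)) L (IsCMField.complexConj L) 3).Adelic → ℂ) g₁ *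
        ((detChar (↥(maximalRealSubfield L)) L (IsCMField.complexConj L) h2 hc 3 ((StdForm.antidiagonal 3).over L) ψ hψ hJ g₁ : ℂˣ) : ℂ))) =
      ((detChar (↥(maximalRealSubfield L)) L (IsCMField.complexConj L) h2 hc 3 ((StdForm.antidiagonal 3).over L) ψ hψ hJ g₁ : ℂˣ) : ℂ) *
        ∑ j, midWitnessQ L μ νG ν h𝓕N h𝓕c h𝓕₀ hβ hμZ hφV hφc hφM hK' hKinf U₀ hU₀o hU₀c hU hVc μa μf bV hbc hbM h2 hc hJ ψ hψ j z *
          ((bV j : ↥(chiSectionSpace (reflectChar (IsCMField.complexConj L) χ) K' ω)) : (quasiSplit (↥(maximalRealSubfield L)) L (IsCMField.complexConj L) 3).Adelic → ℂ) g₁ := by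
    rw [Finset.mul_sum]
    exact Finset.sum_congr rfl fun j _ => by ring
  rw [hsum, ← midWitness_ctQuotient_eq_sum L μ νG ν h𝓕N h𝓕c h𝓕₀ hβ hμZ hφV hφc hφM hK' hKinf U₀ hU₀o hU₀c hU hVc μa μf bV hbc hbM h2 hc hJ ψ hψ hz g₁]
  exact hct z hz

include h𝓕N h𝓕c in
/-- **The same at a base point where `Θ(g₁) = 1`** (e.g. `g₁ = 1`, or `det g₁` in the kernel of `ψ`): `hsrc` from the bare CT-quotient identity `(CT(midWitnessEc z)(g₁) − φ(g₁)H^z)∕H^{2−z} = A·c`.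
[cite: MoeglinWaldspurger1995, II.1.7, IV.1.11] -/
theorem hsrc_of_ctQuotient_at_basePoint_of_detChar_eq_one (A c : ℂ → ℂ) (g₁ : (quasiSplit (↥(maximalRealSubfield L)) L (IsCMField.complexConj L) 3).Adelic)
    (hΘ : ((detChar (↥(maximalRealSubfield L)) L (IsCMField.complexConj L) h2 hc 3 ((StdForm.antidiagonal 3).over L) ψ hψ hJ g₁ : ℂˣ) : ℂ) = 1)
    (hct : ∀ z : ℂ, 2 < z.re →
      (borelConstantTerm ν 𝓕 (midWitnessEc L μ νG ν h𝓕N h𝓕c h𝓕₀ hβ hμZ hφV hφc hφM hK' hKinf U₀ hU₀o hU₀c hU hVc μa μf bV hbc hbM h2 hc hJ ψ hψ z) g₁ -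
          φ g₁ * (((borelHeight g₁ : ℝ≥0) : ℝ) : ℂ) ^ z) / (((borelHeight g₁ : ℝ≥0) : ℝ) : ℂ) ^ (2 - z) = A z * c z) :
    ∀ z : ℂ, 2 < z.re → (∑ j, midWitnessQ L μ νG ν h𝓕N h𝓕c h𝓕₀ hβ hμZ hφV hφc hφM hK' hKinf U₀ hU₀o hU₀c hU hVc μa μf bV hbc hbM h2 hc hJ ψ hψ j z *
      (((bV j : ↥(chiSectionSpace (reflectChar (IsCMField.complexConj L) χ) K' ω)) : (quasiSplit (↥(maximalRealSubfield L)) L (IsCMField.complexConj L) 3).Adelic → ℂ) g₁ *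
        ((detChar (↥(maximalRealSubfield L)) L (IsCMField.complexConj L) h2 hc 3 ((StdForm.antidiagonal 3).over L) ψ hψ hJ g₁ : ℂˣ) : ℂ))) = A z * c z :=
  hsrc_of_ctQuotient_at_basePoint L μ νG ν h𝓕N h𝓕c h𝓕₀ hβ hμZ hφV hφc hφM hK' hKinf U₀ hU₀o hU₀c hU hVc μa μf bV hbc hbM h2 hc hJ ψ hψ A c g₁ fun z hz => by
    rw [hΘ, one_mul]
    exact hct z hz

end Summit.HodgeConjecture.HodgeConjecture.R90.S8

end
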